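import Summits.AtomisticToContinuum.HydrodynamicLimit.Theorems.SpeedCapSurgeryCappedEulerLimitGronwall
import Literature.Analysis.FluidPDE.HardSphereDynamicsProofs
import HarnessLib

/-!
# Route `SpeedCapSurgery`, crux `CappedEulerLimit` (stmt-AtomisticToContinuum-17739): measurability of the cap event

The cap event `capEvent σ t C N Φ = {z | ∀ r ∈ [0,t], ∀ i, ‖v_i(Φ_r z)‖ ≤ C√log(N+2)}` of line `registered`
(`Theorems/SpeedCapSurgeryCappedEulerLimitGronwall.lean`) is an UNCOUNTABLE intersection over the times
`r ∈ [0, t]`, so its measurability is not automatic. This file proves what the capped window entropy step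
(`capped_windowEntropyStep_trunc`, which asks for `NullMeasurableSet S λ_N`) consumes:

* `measurableSet_forall_norm_flow_le` — each time slice `{z | ∀ i, ‖v_i(Φ_r z)‖ ≤ M}` is measurable;
* `capEvent_inter_good_eq` — on the good set `Φ.good` every orbit is a hard-sphere trajectory, whose velocities
  are RIGHT-LOCALLY CONSTANT (free flight on a collision-free interval to the right of every time,
  `IsHardSphereTrajectory.exists_Ioo_right_free` / `eq_freeFlight_of_Ioo_free`, and free flight keeps the
  velocities), so the intersection over `r ∈ [0, t]` equals the intersection over the COUNTABLE set of times
  `[0, t] ∩ ({t} ∪ ℚ)`;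
* `measurableSet_capEvent_inter_good` — hence `capEvent ∩ Φ.good` is measurable;
* `nullMeasurableSet_capEvent` — the local Gibbs law is Liouville-absolutely continuous, hence carried by the
  good set, and `capEvent = (capEvent ∩ good) ∪ (capEvent \ good)` is a measurable set plus a null set.

(`--supports stmt-AtomisticToContinuum-17739`, line `registered`; lead prover-line-stmt-AtomisticToContinuum-17739-c1-0.)
-/

noncomputable section

namespace Summit.AtomisticToContinuum.HydrodynamicLimit.Theorems.CappedEulerLimit

open scoped ENNReal NNReal Topology
open MeasureTheory Filter Set InformationTheory
open Literature.Analysis.FluidPDE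
open Literature.MathematicalPhysics.KineticTheory

/-- The time-`r` slice of the cap event, `{z | ∀ i, ‖v_i(Φ_r z)‖ ≤ M}`, is measurable: `Φ_r` is measurable
(`HardSphereFlow.measurable_flow`) and the condition is a finite intersection of closed conditions on the
velocities. [folklore] -/
theorem measurableSet_forall_norm_flow_le (σ : ℝ) (N : ℕ)
    (Φ : HardSphereFlow (Torus.geometry (Fin 3)) (hsDiameter σ N) (N + 1)) (r M : ℝ) :
    MeasurableSet {z : Config (N + 1) (Fin 3) T3 | ∀ i, ‖(Φ.flow r z i).2‖ ≤ M} := by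
  have hset : {z : Config (N + 1) (Fin 3) T3 | ∀ i, ‖(Φ.flow r z i).2‖ ≤ M} =
      ⋂ i, {z | ‖(Φ.flow r z i).2‖ ≤ M} := by
    ext z
    simp only [mem_setOf_eq, mem_iInter]
  rw [hset]
  refine MeasurableSet.iInter fun i => measurableSet_le ?_ measurable_const
  exact ((measurable_pi_apply i).comp (Φ.measurable_flow r)).snd.norm

/-- **The cap event on the good set is a countable intersection of time slices.** For `z ∈ Φ.good` the orbit
`r ↦ Φ_r z` is a hard-sphere trajectory (`HardSphereFlow.isTrajectory`); to the right of every time `r` there is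
a collision-free interval `(r, u)` (`IsHardSphereTrajectory.exists_Ioo_right_free`) on which the orbit is free
flight from `Φ_r z` (`eq_freeFlight_of_Ioo_free`), which keeps the velocities (`freeFlight_apply`). Hence if
`r ∈ [0, t)` the velocities at time `r` are those at any rational time `q ∈ (r, min u t) ⊆ [0, t]`
(`exists_rat_btwn`), and the speed bound at all times `r ∈ [0, t]` follows from the bound at the countably many
times `[0, t] ∩ ({t} ∪ ℚ)`. (For `t < 0` both index sets are empty.) [folklore] -/
theorem capEvent_inter_good_eq (σ t C : ℝ) (N : ℕ)
    (Φ : HardSphereFlow (Torus.geometry (Fin 3)) (hsDiameter σ N) (N + 1)) :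
    capEvent σ t C N Φ ∩ Φ.good =
      (⋂ r ∈ Icc 0 t ∩ ({t} ∪ range ((↑) : ℚ → ℝ)),
        {z : Config (N + 1) (Fin 3) T3 | ∀ i, ‖(Φ.flow r z i).2‖ ≤ C * Real.sqrt (Real.log ((N : ℝ) + 2))}) ∩
        Φ.good := by
  ext z
  refine ⟨fun hz => ⟨mem_iInter₂.2 fun r hr i => hz.1 r hr.1 i, hz.2⟩, fun hz => ⟨fun r hr i => ?_, hz.2⟩⟩
  have hD : ∀ r ∈ Icc 0 t ∩ ({t} ∪ range ((↑) : ℚ → ℝ)),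
      ∀ i, ‖(Φ.flow r z i).2‖ ≤ C * Real.sqrt (Real.log ((N : ℝ) + 2)) := fun r hr => mem_iInter₂.1 hz.1 r hr
  rcases hr.2.eq_or_lt with hrt | hrt
  · exact hD r ⟨hr, Or.inl hrt⟩ i
  · -- `r < t`: velocities are constant on a collision-free stretch `[r, u)`; test a rational time in `(r, min u t)`
    have htraj := Φ.isTrajectory z hz.2
    obtain ⟨u, hur, hfree⟩ := htraj.exists_Ioo_right_free r
    obtain ⟨q, hrq, hqm⟩ := exists_rat_btwn (lt_min hur hrt)
    have hqu : (q : ℝ) < u := hqm.trans_le (min_le_left _ _)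
    have hqt : (q : ℝ) < t := hqm.trans_le (min_le_right _ _)
    have hflow : Φ.flow q z = freeFlight (Torus.geometry (Fin 3)) (q - r) (Φ.flow r z) :=
      htraj.eq_freeFlight_of_Ioo_free hfree ⟨hrq.le, hqu⟩
    have hvel : (Φ.flow q z i).2 = (Φ.flow r z i).2 := by rw [hflow, freeFlight_apply]
    rw [← hvel]
    exact hD q ⟨⟨hr.1.trans hrq.le, hqt.le⟩, Or.inr (mem_range_self q)⟩ i

/-- **The cap event is measurable on the good set**: by `capEvent_inter_good_eq` it is the good set
(measurable, `HardSphereFlow.measurableSet_good`) intersected with a COUNTABLE intersection (over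
`[0, t] ∩ ({t} ∪ ℚ)`) of measurable time slices (`measurableSet_forall_norm_flow_le`). [folklore] -/
theorem measurableSet_capEvent_inter_good (σ t C : ℝ) (N : ℕ)
    (Φ : HardSphereFlow (Torus.geometry (Fin 3)) (hsDiameter σ N) (N + 1)) :
    MeasurableSet (capEvent σ t C N Φ ∩ Φ.good) := by
  rw [capEvent_inter_good_eq]
  refine MeasurableSet.inter ?_ Φ.measurableSet_good
  have hD : (Icc 0 t ∩ ({t} ∪ range ((↑) : ℚ → ℝ))).Countable :=
    ((countable_singleton t).union (countable_range _)).mono inter_subset_right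
  exact MeasurableSet.biInter hD fun r _ => measurableSet_forall_norm_flow_le σ N Φ r _

/-- **The cap event is null-measurable for the local Gibbs law.** The local Gibbs law
`λ_N = localGibbsLaw σ a₀ u₀ θ₀ N Φ` is absolutely continuous with respect to the Liouville measure
(`localGibbsLaw_eq`, `localGibbsMeasure_absolutelyContinuous`), which is carried by the good set
(`HardSphereFlow.measure_compl_good`), so `λ_N(goodᶜ) = 0`; and
`capEvent = (capEvent ∩ good) ∪ (capEvent \ good)` is the union of a measurable set
(`measurableSet_capEvent_inter_good`) and a subset of the null set `goodᶜ`. [folklore] -/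
theorem nullMeasurableSet_capEvent (σ t C : ℝ) (N : ℕ)
    (Φ : HardSphereFlow (Torus.geometry (Fin 3)) (hsDiameter σ N) (N + 1)) (a₀ θ₀ : T3 → ℝ)
    (u₀ : T3 → V3) : NullMeasurableSet (capEvent σ t C N Φ) (localGibbsLaw σ a₀ u₀ θ₀ N Φ) := by
  have hnull : localGibbsLaw σ a₀ u₀ θ₀ N Φ Φ.goodᶜ = 0 := by
    rw [localGibbsLaw_eq]
    exact localGibbsMeasure_absolutelyContinuous σ a₀ u₀ θ₀ N Φ Φ.measure_compl_good
  rw [← inter_union_sdiff (capEvent σ t C N Φ) Φ.good]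
  exact (measurableSet_capEvent_inter_good σ t C N Φ).nullMeasurableSet.union
    (NullMeasurableSet.of_null (measure_mono_null (sdiff_subset_compl _ _) hnull))

end Summit.AtomisticToContinuum.HydrodynamicLimit.Theorems.CappedEulerLimit

end
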